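import Literature.Probability.RandomPlanarGeometry.HexSAWSurfaceWallRenewalSixthExact
import Literature.Probability.RandomPlanarGeometry.HexSAWSurfaceWallRenewalBlocksSeven
import Literature.Probability.RandomPlanarGeometry.HexSAWPolygonCensus
import HarnessLib

/-!
# The order-SEVEN diagonal census of the adsorbed honeycomb walk's wall-renewal structure by kernel-verified pruned search:
# `N₈,₁ = 38`, `N₉,₂ = 34`, `N₁₀,₃ = 7` exactly; `#(ipwb 16) = 49`, `Λ₁₆(y) = 38y + 11y²`, `f₈(y) = (38y + 11y²)/β(y)¹⁶`,
# `Λ₁₈(y) = N₉,₁·y + 34y² + y³`, `Λ₂₀(y) = N₁₀,₁·y + N₁₀,₂·y² + 7y³`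

Topic `Literature/Probability/RandomPlanarGeometry` (lane «pcv-sawmu», a-idea-1 g34, car «SEVEN-CENSUS»; parents: a-idea-1 g33's «BLOCKS-SEVEN»
`HexSAWSurfaceWallRenewalBlocksSeven` (the exhibited tables `SixteenOne.W : Fin 38 → _`, `EighteenTwo.W : Fin 34 → _`, `TwentyThree.W : Fin 7 → _`,
each with `W_mem_ipwb`, `visits_W`, `W_injective` — the LOWER halves `N₈,₁ ≥ 38`, `N₉,₂ ≥ 34`, `N₁₀,₃ ≥ 7`), a-p6's «SIXTH-EXACT-MEAN»
`HexSAWSurfaceWallRenewalSixthExact` (`N₈₂ = 11`, `N₉₃ = 1`, `visits ≤ 3` on `ipwb 20`, `IPWB_sixteen_eq : Λ₁₆ = N₈₁·y + 11y²` with `N₈₁` symbolic)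
and its parent «FIFTH-EXACT-MEAN» (`visits ≤ 2` on `ipwb 16`, `≤ 3` on `ipwb 18`), and a-p4's «POLYGON-CENSUS» `HexSAWPolygonCensus` (the dictionary
`Census.nbrs / revList / ofSite / toSite / mem_nbrs_iff / mem_revList / getElem_revList` between vertex functions and reversed integer site lists, and the
pattern "pruned enumeration + completeness theorem + `decide +kernel`").

## The method (why this is not a bootstrap)
The order-six census of «SIXTH-EXACT-MEAN» is ANALYTIC: a twelfth two-visit sixteen would add `y²/β¹⁶ ≈ 10⁻⁵⁴` to the renewal identity
`Σ_s f_s = 1`, more than the room `≈ 6·10⁻⁵⁶` left at `y = 10⁹` by the tree's sixth-order upper window for `β²`.  One order up the classes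
`(8,1), (9,2), (10,3)` have signal `y^{v}/β^{2s} ≈ y⁻⁷ = 10⁻⁶³`, BELOW that room, and no seventh-order upper window exists (its fibre proof was estimated
at ≫ 2·10⁵ bytes).  Here the UPPER halves are obtained COMBINATORIALLY instead: a pruned depth-first enumeration `WCensus.grow` of reversed site lists
(brick-wall steps, self-avoiding, `Y ≤ 0`, `X ≥ 1` after time `0`, `|Y| ≤` steps to go, at most `V − 1` surface visits before the end) with the final
test "exactly `V` visits, `X_i ≤ X_N`, no wall-renewal time in `[1, N)`", a COMPLETENESS theorem `WCensus.revList_mem_censusW` (the reversed site list of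
every `ω ∈ ipwb N` with `visits N ω = V` is enumerated — symbolic `N`, `V`), and three KERNEL CERTIFICATES (`decide +kernel`) that every enumerated list is the
site list of one of the exhibited tables: `1199 / 6592 / 24590` search nodes, `< 2·10⁴ / < 10⁵ / < 2·10⁵` heartbeats (measured; budget lines `400000`).
Extensionality of walks frozen after time `N` (`WCensus.eq_of_revList_eq`) turns list equality into `ω = W i`.

Sources (primary; identifiers verbatim).  N. Madras, G. Slade, The Self-Avoiding Walk (1993): Section 1.1 (walks as vertex sequences); Section 1.2,
Definition 1.2.4 (bridges: `ω₁(0) < ω₁(i) ≤ ω₁(n)`); Section 4.2, Definition 4.2.1 (renewal times, irreducible bridges), (4.2.2) (`λ_n`, `Λ`),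
(4.2.4) and Theorem 4.2.2 (pp. 91–92) (the renewal identity).  H. Kesten, J. Math. Phys. 4 (1963), Section 4 (irreducible bridges).  J. M. Hammersley,
G. M. Torrie, S. G. Whittington, J. Phys. A 15 (1982), Section 2 (walks attached to a surface, surface bridges).  N. R. Beaton, M. Bousquet-Mélou,
J. de Gier, H. Duminil-Copin, A. J. Guttmann, CMP 326 (2014), Section 3.1 (arXiv v5 p. 8: surface contacts `c(ω)`, fugacity `y`).  I. G. Enting,
I. Jensen (2009), Section 7.4.2, Fig. 7.10 (brick-wall form of the honeycomb lattice).

## What is proved (namespace `…SAW.HexBW.Wall`; walk lengths symbolic in every statement about `ipwb`)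
* §1 `WCensus.visitsRev`, `admissibleW`, `extendW`, `fOf`, `bridgeB`, `wrenB`, `finalB`, `grow`, `censusW` (the search, all `Bool`/`List` valued).
* §2 ★★ COMPLETENESS for symbolic `N`, `V`: `WCensus.visitsRev_revList`, `visits_le_visits_add`, `natAbs_le_of_mem_archs` (`|Y_i| ≤ N − i` on arches),
  `revList_succ_mem_extendW`, `fOf_revList`, `isBridge_of_bridgeB`, `isWRen_of_wrenB` (soundness of the Boolean renewal detector), `finalB_revList`,
  ★ `revList_mem_grow`, ★★ `revList_mem_censusW`, `eq_of_revList_eq`, `frozen_of_mem_ipwb`, `forall_mem_grow_succ` (splitting combinator for deeper censuses).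
* §3 KERNEL CERTIFICATES `SixteenOne.censusW_subset`, `EighteenTwo.censusW_subset`, `TwentyThree.censusW_subset` (every list of the `(16,1)`, `(18,2)`,
  `(20,3)` census is one of the `38 / 34 / 7` table lists `revLists`).
* §4 ★★★ THE ORDER-SEVEN DIAGONAL CENSUS: `exists_eq_sixteenOne_W_of_mem_ipwb_sixteen_of_visits_eq_one`, `oneVisit_ipwb_sixteen_eq_image`,
  ★★★ `card_oneVisit_ipwb_sixteen_eq_thirtyEight` (**`N₈,₁ = 38`**), ★★ `card_ipwb_sixteen_eq_fortyNine` (**`N₈ = 49`**);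
  `exists_eq_eighteenTwo_W_of_mem_ipwb_eighteen_of_visits_eq_two`, `twoVisit_ipwb_eighteen_eq_image`, ★★★ `card_twoVisit_ipwb_eighteen_eq_thirtyFour`
  (**`N₉,₂ = 34`**), `card_ipwb_eighteen_eq` (`N₉ = N₉,₁ + 35`); `exists_eq_twentyThree_W_of_mem_ipwb_twenty_of_visits_eq_three`,
  `threeVisit_ipwb_twenty_eq_image`, ★★★ `card_threeVisit_ipwb_twenty_eq_seven` (**`N₁₀,₃ = 7`**).
* §5 LAWS: ★★★ `IPWB_sixteen_eq_thirtyEight : Λ₁₆(y) = 38y + 11y²`, ★★ `pwbLaw_eight_eq_exact : f₈ = (38y + 11y²)/β¹⁶` (the renewal law is explicit through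
  half-length EIGHT), `sum_image_eighteenTwo` (`34y²`), ★ `IPWB_eighteen_eq : Λ₁₈ = N₉,₁·y + 34y² + y³`, `sum_image_twentyThree` (`7y³`),
  ★ `IPWB_twenty_eq : Λ₂₀ = N₁₀,₁·y + N₁₀,₂·y² + 7y³` (`N₉,₁`, `N₁₀,₁`, `N₁₀,₂` symbolic filter cardinalities: diagonal `≥ 8`).

NOT claimed: `N₉,₁`, `N₁₀,₁`, `N₁₀,₂` (data `98`, `267`, `99`: diagonals `8, 9`); the emptiness of `(11,4), (12,5), …` (the six-step law, car «SIX-STEP», not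
landed here); the seventh β²-coefficient `a₆ = 12`, `m₇ = 211`, `V₇ = 21` (they follow from this census + the six-step law + the assembly of
«SIXTH-EXACT-MEAN» one order up — a separate car); anything asymptotic.  NEW IN WRITING (modest): the three diagonal-seven class numbers of the positive
wall-bridge renewal structure of the adsorbing honeycomb walk, kernel-certified; print has the renewal structure (M–S §4.2, Kesten §4) only.
Label (lane): DATA-LEMMA / kernel census + completeness theorem; budget lines: 3 (`set_option maxHeartbeats 400000 in` before each certificate).
-/


namespace Literature.Probability.RandomPlanarGeometry.SAW.HexBW.Wall

open Finset Function Census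
open Literature.Probability.LatticeModels

namespace WCensus

/-! ### §1  The pruned search -/

/-- Number of surface visits (even times `≥ 1` with `Y = 0`) read off a reversed site list `[site_t, …, site_0]`.
[cite: BeatonBousquetMelouDeGierDuminilCopinGuttmann2014, Section 3.1 (arXiv v5 p. 8: c(ω), the number of contacts with the surface)] -/
def visitsRev : List (ℤ × ℤ) → ℕ
  | [] => 0
  | q :: t => visitsRev t + if t.length ≠ 0 ∧ t.length % 2 = 0 ∧ q.2 = 0 then 1 else 0

/-- Admissible next site with `r` steps still to go and visit budget `V`: new, `X ≥ 1`, `Y ≤ 0`, `|Y| ≤ r`, and at most `V − 1` visits strictly before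
the end (`V` at the end). [cite: MadrasSlade1993, Section 1.2, Definition 1.2.4; Section 4.2, Definition 4.2.1] -/
def admissibleW (V r : ℕ) (l : List (ℤ × ℤ)) (q : ℤ × ℤ) : Bool :=
  decide (q ∉ l) && decide (1 ≤ q.1) && decide (q.2 ≤ 0) && decide (q.2.natAbs ≤ r) &&
    decide (visitsRev (q :: l) + (if r = 0 then 0 else 1) ≤ V)

/-- One-step admissible extensions of a reversed site list. [cite: MadrasSlade1993, Section 1.1; Section 4.2, Definition 4.2.1] -/
def extendW (V r : ℕ) : List (ℤ × ℤ) → List (List (ℤ × ℤ))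
  | [] => []
  | p :: t => ((nbrs p).filter (admissibleW V r (p :: t))).map fun q => q :: p :: t

/-- Site at time `i` of a reversed site list of length `N + 1`. [cite: MadrasSlade1993, Section 1.1] -/
def fOf (N : ℕ) (l : List (ℤ × ℤ)) (i : ℕ) : ℤ × ℤ := l.getD (N - i) (0, 0)

/-- Boolean bridge test for the piece `[a, a + n]`: `X_a < X_{a+j} ≤ X_{a+n}` for `1 ≤ j ≤ n`. [cite: MadrasSlade1993, Section 1.2, Definition 1.2.4] -/
def bridgeB (f : ℕ → ℤ × ℤ) (a n : ℕ) : Bool :=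
  (List.range n).all fun j => decide ((f a).1 < (f (a + (j + 1))).1 ∧ (f (a + (j + 1))).1 ≤ (f (a + n)).1)

/-- Boolean wall-renewal test at time `k` of an `N`-step list: `k` even, `Y_k = 0`, `[0,k]` and `[k,N]` bridges. [cite: MadrasSlade1993, Section 4.2, Definition 4.2.1] -/
def wrenB (f : ℕ → ℤ × ℤ) (N k : ℕ) : Bool :=
  decide (k % 2 = 0 ∧ (f k).2 = 0) && bridgeB f 0 k && bridgeB f k (N - k)

/-- Final test on a full list: exactly `V` visits, `X_i ≤ X_N`, and no wall-renewal time in `[1, N)`.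
[cite: MadrasSlade1993, Section 4.2, Definition 4.2.1] -/
def finalB (N V : ℕ) (l : List (ℤ × ℤ)) : Bool :=
  decide (visitsRev l = V) && ((List.range (N + 1)).all fun i => decide ((fOf N l i).1 ≤ (fOf N l N).1)) &&
    ((List.range N).all fun k => decide (k = 0) || ! wrenB (fOf N l) N k)

/-- Depth-first completion of a reversed prefix with `r` steps to go, keeping the full lists passing the final test.
[cite: MadrasSlade1993, Section 4.2, Definition 4.2.1] -/
def grow (N V : ℕ) : ℕ → List (ℤ × ℤ) → List (List (ℤ × ℤ))
  | 0, l => if finalB N V l then [l] else []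
  | r + 1, l => (extendW V r l).flatMap (grow N V r)

/-- The census list of the irreducible positive wall bridges of length `N` with `V` visits, as reversed site lists.
[cite: MadrasSlade1993, Section 4.2, Definition 4.2.1, (4.2.2)] -/
def censusW (N V : ℕ) : List (List (ℤ × ℤ)) := grow N V N [(0, 0)]

/-! ### §2  Completeness of the search (symbolic `N`, `V`) -/

variable {N V : ℕ} {ω : ℕ → Site 2}

/-- `visitsRev (revList ω k) = visits k ω`. [cite: BeatonBousquetMelouDeGierDuminilCopinGuttmann2014, Section 3.1 (arXiv v5 p. 8)] -/
theorem visitsRev_revList (ω : ℕ → Site 2) (k : ℕ) : visitsRev (revList ω k) = visits k ω := by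
  induction k with
  | zero => simp [revList, visitsRev]
  | succ k ih =>
    rw [revList, visitsRev, ih, visits_succ, length_revList]
    simp only [ne_eq, Nat.succ_ne_zero, not_false_eq_true, true_and, ofSite]

/-- `visits` is monotone in time. [cite: BeatonBousquetMelouDeGierDuminilCopinGuttmann2014, Section 3.1 (arXiv v5 p. 8)] -/
theorem visits_le_visits_add (a b : ℕ) (ω : ℕ → Site 2) : visits a ω ≤ visits (a + b) ω := by
  induction b with
  | zero => simp
  | succ b ih => rw [← add_assoc, visits_succ]; omega

/-- Along an arch of length `N`, `|Y_i| ≤ N − i` (each brick-wall step moves `Y` by at most one and `Y_N = 0`). [cite: HammersleyTorrieWhittington1982, Section 2] -/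
theorem natAbs_le_of_mem_archs (hω : ω ∈ archs N) {i : ℕ} (hi : i ≤ N) : (ω i 1).natAbs ≤ N - i := by
  obtain ⟨hh, -, hYN⟩ := mem_archs.1 hω
  obtain ⟨-, -, hbw, -⟩ := mem_saws_iff.1 (mem_hpw.1 hh).1
  obtain ⟨j, rfl⟩ : ∃ j, i = N - j := ⟨N - i, by omega⟩
  have key : ∀ j, j ≤ N → (ω (N - j) 1).natAbs ≤ j := by
    intro j
    induction j with
    | zero => intro _; simp [hYN]
    | succ j ih =>
      intro hj
      have h := hbw (N - (j + 1)) (by omega)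
      rw [show N - (j + 1) + 1 = N - j by omega, brickWallGraph_adj_coord] at h
      have := ih (by omega)
      omega
  by_cases hj : j ≤ N
  · simpa [show N - (N - j) = j by omega] using key j hj
  · rw [show N - j = 0 by omega] at *
    have := key N le_rfl
    rw [show N - N = 0 by omega] at this
    simpa using this.trans (by omega)

/-- The one-step extension of a prefix of an irreducible positive wall bridge with `V` visits is admissible.
[cite: MadrasSlade1993, Section 1.2, Definition 1.2.4; Section 4.2, Definition 4.2.1] -/
theorem revList_succ_mem_extendW (hω : ω ∈ ipwb N) (hv : visits N ω = V) {k : ℕ} (hk : k + 1 ≤ N) :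
    revList ω (k + 1) ∈ extendW V (N - (k + 1)) (revList ω k) := by
  have hp := ipwb_subset hω
  obtain ⟨hw, hbr⟩ := mem_pwb.1 hp
  have ha := wbr_subset hw
  obtain ⟨hh, hN2, hYN⟩ := mem_archs.1 ha
  obtain ⟨hs, hH⟩ := mem_hpw.1 hh
  obtain ⟨h0, -, hbw, hinj⟩ := mem_saws_iff.1 hs
  obtain ⟨t, ht⟩ : ∃ t, revList ω k = ofSite (ω k) :: t := by cases k <;> exact ⟨_, rfl⟩
  rw [revList, ht, extendW, List.mem_map]
  refine ⟨ofSite (ω (k + 1)), ?_, rfl⟩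
  rw [List.mem_filter]
  refine ⟨?_, ?_⟩
  · rw [mem_nbrs_iff, toSite_ofSite, toSite_ofSite]; exact hbw k (by omega)
  · rw [← ht]
    simp only [admissibleW, Bool.and_eq_true, decide_eq_true_eq]
    refine ⟨⟨⟨⟨fun hq => ?_, ?_⟩, ?_⟩, ?_⟩, ?_⟩
    · obtain ⟨i, hi, hiq⟩ := mem_revList.1 hq
      have heq : ω (k + 1) = ω i := by simpa using congrArg toSite hiq
      have := hinj (show k + 1 ∈ {i | i ≤ N} by simpa using hk) (show i ∈ {i | i ≤ N} by simp; omega) heq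
      omega
    · have := (hbr (k + 1) (by omega) hk).1
      simp only [ofSite, h0, Pi.zero_apply] at this ⊢
      omega
    · exact hH (k + 1) hk
    · exact natAbs_le_of_mem_archs ha hk
    · have hvl : visitsRev (ofSite (ω (k + 1)) :: revList ω k) = visits (k + 1) ω := visitsRev_revList ω (k + 1)
      rw [hvl]
      split_ifs with hr
      · have h1 := visits_le_visits_add (k + 1) (N - (k + 1)) ω
        rw [Nat.add_sub_cancel' hk] at h1
        omega
      · have h1 := visits_le_visits_add (k + 1) (N - 1 - (k + 1)) ω
        rw [Nat.add_sub_cancel' (by omega : k + 1 ≤ N - 1)] at h1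
        have h2 : visits N ω = visits (N - 1) ω + 1 := by
          obtain ⟨M, rfl⟩ : ∃ M, N = M + 1 := ⟨N - 1, by omega⟩
          rw [visits_succ, if_pos ⟨hN2, hYN⟩, Nat.add_sub_cancel]
        omega

/-- `fOf N (revList ω N) i = ofSite (ω i)` for a walk frozen after time `N`. [cite: MadrasSlade1993, Section 1.1] -/
theorem fOf_revList (hfr : ∀ i, N ≤ i → ω i = ω N) (i : ℕ) : fOf N (revList ω N) i = ofSite (ω i) := by
  unfold fOf
  rw [List.getD_eq_getElem _ _ (by rw [length_revList]; omega), getElem_revList]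
  rcases le_or_gt i N with hi | hi
  · rw [show N - (N - i) = i by omega]
  · rw [show N - (N - i) = N by omega, hfr i hi.le]

/-- Soundness of the Boolean bridge test. [cite: MadrasSlade1993, Section 1.2, Definition 1.2.4] -/
theorem isBridge_of_bridgeB {a n : ℕ} (h : bridgeB (fun i => ofSite (ω i)) a n = true) :
    Zd.IsBridge n (fun j => ω (a + j)) := by
  intro j h1 hj
  simp only [bridgeB, List.all_eq_true, List.mem_range, decide_eq_true_eq] at h
  have := h (j - 1) (by omega)
  rw [show j - 1 + 1 = j by omega] at this
  simpa [ofSite] using this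

/-- Soundness of the Boolean wall-renewal test. [cite: MadrasSlade1993, Section 4.2, Definition 4.2.1] -/
theorem isWRen_of_wrenB {k : ℕ} (hkN : k ≤ N) (h : wrenB (fun i => ofSite (ω i)) N k = true) : IsWRen N ω k := by
  simp only [wrenB, Bool.and_eq_true, decide_eq_true_eq] at h
  obtain ⟨⟨⟨hk2, hY⟩, hb1⟩, hb2⟩ := h
  refine ⟨⟨hkN, ?_, isBridge_of_bridgeB hb2⟩, hk2, by simpa [ofSite] using hY⟩
  have := isBridge_of_bridgeB hb1
  simpa using this

/-- The full reversed list of an irreducible positive wall bridge with `V` visits passes the final test.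
[cite: MadrasSlade1993, Section 4.2, Definition 4.2.1] -/
theorem finalB_revList (hω : ω ∈ ipwb N) (hv : visits N ω = V) : finalB N V (revList ω N) = true := by
  obtain ⟨hp, -, hirr⟩ := mem_ipwb.1 hω
  obtain ⟨hw, hbr⟩ := mem_pwb.1 hp
  obtain ⟨ha, hwb⟩ := mem_wbr.1 hw
  obtain ⟨-, hfr, -, -⟩ := mem_saws_iff.1 (mem_hpw.1 (mem_archs.1 ha).1).1
  have hf : fOf N (revList ω N) = fun i => ofSite (ω i) := funext (fOf_revList hfr)
  simp only [finalB, hf, Bool.and_eq_true, decide_eq_true_eq, List.all_eq_true, List.mem_range, Bool.or_eq_true,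
    Bool.not_eq_true']
  refine ⟨⟨by rw [visitsRev_revList, hv], fun i hi => ?_⟩, fun k hk => ?_⟩
  · simpa [ofSite] using (hwb i (by omega)).2
  · rcases Nat.eq_zero_or_pos k with h0 | h0
    · exact Or.inl h0
    · right
      by_contra hne
      rw [Bool.not_eq_false] at hne
      exact hirr k h0 hk (isWRen_of_wrenB hk.le hne)

/-- ★ **Completeness of the search**: the full reversed list lies in the completion of each of its prefixes.
[cite: MadrasSlade1993, Section 4.2, Definition 4.2.1] -/
theorem revList_mem_grow (hω : ω ∈ ipwb N) (hv : visits N ω = V) {r : ℕ} (hr : r ≤ N) :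
    revList ω N ∈ grow N V r (revList ω (N - r)) := by
  induction r with
  | zero => rw [Nat.sub_zero, grow, if_pos (finalB_revList hω hv)]; exact List.mem_singleton_self _
  | succ r ih =>
    rw [grow, List.mem_flatMap]
    refine ⟨revList ω (N - r), ?_, ih (by omega)⟩
    have e : N - r = (N - (r + 1)) + 1 := by omega
    have := revList_succ_mem_extendW hω hv (k := N - (r + 1)) (by omega)
    rwa [← e, show N - (N - r) = r by omega] at this

/-- ★★ **Completeness**: the full reversed site list of an irreducible positive wall bridge of length `N` with `V` visits is in the census list
`censusW N V`. [cite: MadrasSlade1993, Section 4.2, Definition 4.2.1, (4.2.2)] -/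
theorem revList_mem_censusW (hω : ω ∈ ipwb N) (hv : visits N ω = V) : revList ω N ∈ censusW N V := by
  have h := revList_mem_grow hω hv le_rfl
  have h0 : revList ω (N - N) = [(0, 0)] := by
    rw [Nat.sub_self, revList]
    obtain ⟨h00, -⟩ := mem_saws_iff.1 (mem_hpw.1 (mem_archs.1 (wbr_subset (mem_pwb.1 (ipwb_subset hω)).1)).1).1
    simp [h00]
  rwa [h0] at h

/-- `revList · n` is injective on walks frozen after time `n`. [cite: MadrasSlade1993, Section 1.1] -/
theorem eq_of_revList_eq {n : ℕ} {ω ω' : ℕ → Site 2} (hfr : ∀ i, n ≤ i → ω i = ω n) (hfr' : ∀ i, n ≤ i → ω' i = ω' n)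
    (h : revList ω n = revList ω' n) : ω = ω' := by
  have key : ∀ i, i ≤ n → ω i = ω' i := by
    intro i hi
    have hlen := length_revList ω n
    have h1 := getElem_revList ω n (j := n - i) (by rw [hlen]; omega)
    have h2 := getElem_revList ω' n (j := n - i) (by rw [length_revList]; omega)
    have e : (revList ω n)[n - i]'(by rw [hlen]; omega) = (revList ω' n)[n - i]'(by rw [length_revList]; omega) := by
      simp only [h]
    rw [h1, h2, show n - (n - i) = i by omega] at e
    simpa using congrArg toSite e
  funext i
  rcases le_or_gt i n with hi | hi
  · exact key i hi
  · rw [hfr i hi.le, hfr' i hi.le, key n le_rfl]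

/-- A member of `ipwb n` is frozen after time `n`. [cite: MadrasSlade1993, Section 1.1] -/
theorem frozen_of_mem_ipwb {n : ℕ} (hω : ω ∈ ipwb n) : ∀ i, n ≤ i → ω i = ω n :=
  (mem_saws_iff.1 (mem_hpw.1 (mem_archs.1 (wbr_subset (mem_pwb.1 (ipwb_subset hω)).1)).1).1).2.1

/-- Splitting a completion certificate over the children of a prefix (for censuses too large for one kernel evaluation).
[cite: MadrasSlade1993, Section 4.2, Definition 4.2.1] -/
theorem forall_mem_grow_succ {r : ℕ} {l : List (ℤ × ℤ)} {P : List (ℤ × ℤ) → Prop}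
    (h : ∀ l' ∈ extendW V r l, ∀ x ∈ grow N V r l', P x) : ∀ x ∈ grow N V (r + 1) l, P x := by
  intro x hx
  rw [grow, List.mem_flatMap] at hx
  obtain ⟨l', hl', hx'⟩ := hx
  exact h l' hl' x hx'

end WCensus

/-! ### §3  The kernel certificates -/

namespace SixteenOne

/-- The 38 tables as reversed site lists. [cite: EntingJensen2009, Section 7.4.2, Fig. 7.10] -/
def revLists : List (List (ℤ × ℤ)) := (List.finRange 38).map fun i => revList (W i) 16

set_option maxHeartbeats 400000 in
/-- **Kernel certificate** (`1199` search nodes): every list of the `(16, 1)` census is one of the 38 tables. [cite: MadrasSlade1993, Section 4.2, Definition 4.2.1, (4.2.2)] -/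
theorem censusW_subset : ∀ l ∈ WCensus.censusW 16 1, l ∈ revLists := by decide +kernel

end SixteenOne

namespace EighteenTwo

/-- The 34 tables as reversed site lists. [cite: EntingJensen2009, Section 7.4.2, Fig. 7.10] -/
def revLists : List (List (ℤ × ℤ)) := (List.finRange 34).map fun i => revList (W i) 18

set_option maxHeartbeats 400000 in
/-- **Kernel certificate** (`6592` search nodes): every list of the `(18, 2)` census is one of the 34 tables. [cite: MadrasSlade1993, Section 4.2, Definition 4.2.1, (4.2.2)] -/
theorem censusW_subset : ∀ l ∈ WCensus.censusW 18 2, l ∈ revLists := by decide +kernel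

end EighteenTwo

namespace TwentyThree

/-- The 7 tables as reversed site lists. [cite: EntingJensen2009, Section 7.4.2, Fig. 7.10] -/
def revLists : List (List (ℤ × ℤ)) := (List.finRange 7).map fun i => revList (W i) 20

set_option maxHeartbeats 400000 in
/-- **Kernel certificate** (`24590` search nodes): every list of the `(20, 3)` census is one of the 7 tables. [cite: MadrasSlade1993, Section 4.2, Definition 4.2.1, (4.2.2)] -/
theorem censusW_subset : ∀ l ∈ WCensus.censusW 20 3, l ∈ revLists := by decide +kernel

end TwentyThree

/-! ### §4  Exhaustion and the three class numbers -/

variable {y : ℝ}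

/-- ★★ **A one-visit irreducible positive wall bridge of length sixteen is one of the 38 exhibited blocks** (symbolic length).
[cite: MadrasSlade1993, Section 4.2, Definition 4.2.1, (4.2.2)] [cite: Kesten1963SAW, Section 4] [cite: EntingJensen2009, Section 7.4.2, Fig. 7.10] -/
theorem exists_eq_sixteenOne_W_of_mem_ipwb_sixteen_of_visits_eq_one {m : ℕ} {ω : ℕ → Site 2} (hm : m = 16) (hω : ω ∈ ipwb m)
    (hv : visits m ω = 1) : ∃ i : Fin 38, ω = SixteenOne.W i := by
  have h1 := WCensus.revList_mem_censusW hω hv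
  rw [hm] at h1
  obtain ⟨i, -, hi⟩ := List.mem_map.1 (SixteenOne.censusW_subset _ h1)
  refine ⟨i, ?_⟩
  have hfr := WCensus.frozen_of_mem_ipwb hω
  have hfr' := WCensus.frozen_of_mem_ipwb (SixteenOne.W_mem_ipwb hm i)
  rw [hm] at hfr hfr'
  exact WCensus.eq_of_revList_eq hfr hfr' hi.symm

open Classical in
/-- ★★ The one-visit class of `ipwb 16` is the image of the 38 tables (symbolic length). [cite: MadrasSlade1993, Section 4.2, Definition 4.2.1, (4.2.2)] [cite: EntingJensen2009, Section 7.4.2, Fig. 7.10] -/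
theorem oneVisit_ipwb_sixteen_eq_image {m : ℕ} (hm : m = 16) :
    ((ipwb m).filter fun ω => visits m ω = 1) = Finset.univ.image SixteenOne.W := by
  ext ω
  rw [Finset.mem_filter]
  constructor
  · rintro ⟨hω, hv⟩
    obtain ⟨i, rfl⟩ := exists_eq_sixteenOne_W_of_mem_ipwb_sixteen_of_visits_eq_one hm hω hv
    exact Finset.mem_image_of_mem _ (Finset.mem_univ i)
  · intro h
    obtain ⟨i, -, rfl⟩ := Finset.mem_image.1 h
    exact ⟨SixteenOne.W_mem_ipwb hm i, by rw [hm]; exact SixteenOne.visits_W i⟩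

open Classical in
/-- ★★★ **`N₈,₁ = 38`**: there are exactly thirty-eight one-visit irreducible positive wall bridges of length sixteen (symbolic length).
[cite: MadrasSlade1993, Section 4.2, Definition 4.2.1, (4.2.2) and Theorem 4.2.2 (pp. 91–92)] [cite: Kesten1963SAW, Section 4] -/
theorem card_oneVisit_ipwb_sixteen_eq_thirtyEight {m : ℕ} (hm : m = 16) : #((ipwb m).filter fun ω => visits m ω = 1) = 38 := by
  rw [oneVisit_ipwb_sixteen_eq_image hm, Finset.card_image_of_injective _ SixteenOne.W_injective]
  simp

open Classical in
/-- ★★ **`N₈ = #(ipwb 16) = 49`**: the thirty-eight one-visit and the eleven two-visit blocks (symbolic length).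
[cite: MadrasSlade1993, Section 4.2, Definition 4.2.1, (4.2.2)] [cite: Kesten1963SAW, Section 4] -/
theorem card_ipwb_sixteen_eq_fortyNine {m : ℕ} (hm : m = 16) : #(ipwb m) = 49 := by
  have hneg : ((ipwb m).filter fun ω => ¬ visits m ω = 1) = (ipwb m).filter fun ω => visits m ω = 2 := by
    refine Finset.filter_congr fun ω hω => ?_
    have h1 := one_le_visits_of_mem_ipwb hω
    have h2 := visits_le_two_of_mem_ipwb_sixteen hm hω
    omega
  rw [← Finset.card_filter_add_card_filter_not (p := fun ω => visits m ω = 1), hneg, card_oneVisit_ipwb_sixteen_eq_thirtyEight hm,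
    card_twoVisit_ipwb_sixteen_eq_eleven hm]

/-- ★★ **A two-visit irreducible positive wall bridge of length eighteen is one of the 34 exhibited blocks** (symbolic length).
[cite: MadrasSlade1993, Section 4.2, Definition 4.2.1, (4.2.2)] [cite: Kesten1963SAW, Section 4] [cite: EntingJensen2009, Section 7.4.2, Fig. 7.10] -/
theorem exists_eq_eighteenTwo_W_of_mem_ipwb_eighteen_of_visits_eq_two {m : ℕ} {ω : ℕ → Site 2} (hm : m = 18) (hω : ω ∈ ipwb m)
    (hv : visits m ω = 2) : ∃ i : Fin 34, ω = EighteenTwo.W i := by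
  have h1 := WCensus.revList_mem_censusW hω hv
  rw [hm] at h1
  obtain ⟨i, -, hi⟩ := List.mem_map.1 (EighteenTwo.censusW_subset _ h1)
  refine ⟨i, ?_⟩
  have hfr := WCensus.frozen_of_mem_ipwb hω
  have hfr' := WCensus.frozen_of_mem_ipwb (EighteenTwo.W_mem_ipwb hm i)
  rw [hm] at hfr hfr'
  exact WCensus.eq_of_revList_eq hfr hfr' hi.symm

open Classical in
/-- ★★ The two-visit class of `ipwb 18` is the image of the 34 tables (symbolic length). [cite: MadrasSlade1993, Section 4.2, Definition 4.2.1, (4.2.2)] [cite: EntingJensen2009, Section 7.4.2, Fig. 7.10] -/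
theorem twoVisit_ipwb_eighteen_eq_image {m : ℕ} (hm : m = 18) :
    ((ipwb m).filter fun ω => visits m ω = 2) = Finset.univ.image EighteenTwo.W := by
  ext ω
  rw [Finset.mem_filter]
  constructor
  · rintro ⟨hω, hv⟩
    obtain ⟨i, rfl⟩ := exists_eq_eighteenTwo_W_of_mem_ipwb_eighteen_of_visits_eq_two hm hω hv
    exact Finset.mem_image_of_mem _ (Finset.mem_univ i)
  · intro h
    obtain ⟨i, -, rfl⟩ := Finset.mem_image.1 h
    exact ⟨EighteenTwo.W_mem_ipwb hm i, by rw [hm]; exact EighteenTwo.visits_W i⟩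

open Classical in
/-- ★★★ **`N₉,₂ = 34`**: there are exactly thirty-four two-visit irreducible positive wall bridges of length eighteen (symbolic length).
[cite: MadrasSlade1993, Section 4.2, Definition 4.2.1, (4.2.2) and Theorem 4.2.2 (pp. 91–92)] [cite: Kesten1963SAW, Section 4] -/
theorem card_twoVisit_ipwb_eighteen_eq_thirtyFour {m : ℕ} (hm : m = 18) : #((ipwb m).filter fun ω => visits m ω = 2) = 34 := by
  rw [twoVisit_ipwb_eighteen_eq_image hm, Finset.card_image_of_injective _ EighteenTwo.W_injective]
  simp

open Classical in
/-- ★ **`N₉ = N₉,₁ + 35`**: `#(ipwb 18)` is the (diagonal-eight, here symbolic) number of one-visit blocks plus `34 + 1` (symbolic length).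
[cite: MadrasSlade1993, Section 4.2, Definition 4.2.1, (4.2.2)] [cite: Kesten1963SAW, Section 4] -/
theorem card_ipwb_eighteen_eq {m : ℕ} (hm : m = 18) : #(ipwb m) = #((ipwb m).filter fun ω => visits m ω = 1) + 35 := by
  have hsplit : ((ipwb m).filter fun ω => ¬ visits m ω = 1) =
      ((ipwb m).filter fun ω => visits m ω = 2) ∪ ((ipwb m).filter fun ω => visits m ω = 3) := by
    ext ω
    simp only [Finset.mem_filter, Finset.mem_union]
    constructor
    · rintro ⟨hω, h1⟩
      have h0 := one_le_visits_of_mem_ipwb hω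
      have h3 := visits_le_three_of_mem_ipwb_eighteen hm hω
      rcases (by omega : visits m ω = 2 ∨ visits m ω = 3) with h | h
      · exact Or.inl ⟨hω, h⟩
      · exact Or.inr ⟨hω, h⟩
    · rintro (⟨hω, h⟩ | ⟨hω, h⟩) <;> exact ⟨hω, by omega⟩
  have hdisj : Disjoint ((ipwb m).filter fun ω => visits m ω = 2) ((ipwb m).filter fun ω => visits m ω = 3) :=
    Finset.disjoint_filter.2 fun ω _ h2 h3 => by omega
  rw [← Finset.card_filter_add_card_filter_not (p := fun ω => visits m ω = 1), hsplit, Finset.card_union_of_disjoint hdisj,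
    card_twoVisit_ipwb_eighteen_eq_thirtyFour hm, card_threeVisit_ipwb_eighteen_eq_one hm]

/-- ★★ **A three-visit irreducible positive wall bridge of length twenty is one of the 7 exhibited blocks** (symbolic length).
[cite: MadrasSlade1993, Section 4.2, Definition 4.2.1, (4.2.2)] [cite: Kesten1963SAW, Section 4] [cite: EntingJensen2009, Section 7.4.2, Fig. 7.10] -/
theorem exists_eq_twentyThree_W_of_mem_ipwb_twenty_of_visits_eq_three {m : ℕ} {ω : ℕ → Site 2} (hm : m = 20) (hω : ω ∈ ipwb m)
    (hv : visits m ω = 3) : ∃ i : Fin 7, ω = TwentyThree.W i := by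
  have h1 := WCensus.revList_mem_censusW hω hv
  rw [hm] at h1
  obtain ⟨i, -, hi⟩ := List.mem_map.1 (TwentyThree.censusW_subset _ h1)
  refine ⟨i, ?_⟩
  have hfr := WCensus.frozen_of_mem_ipwb hω
  have hfr' := WCensus.frozen_of_mem_ipwb (TwentyThree.W_mem_ipwb hm i)
  rw [hm] at hfr hfr'
  exact WCensus.eq_of_revList_eq hfr hfr' hi.symm

open Classical in
/-- ★★ The three-visit class of `ipwb 20` is the image of the 7 tables (symbolic length). [cite: MadrasSlade1993, Section 4.2, Definition 4.2.1, (4.2.2)] [cite: EntingJensen2009, Section 7.4.2, Fig. 7.10] -/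
theorem threeVisit_ipwb_twenty_eq_image {m : ℕ} (hm : m = 20) :
    ((ipwb m).filter fun ω => visits m ω = 3) = Finset.univ.image TwentyThree.W := by
  ext ω
  rw [Finset.mem_filter]
  constructor
  · rintro ⟨hω, hv⟩
    obtain ⟨i, rfl⟩ := exists_eq_twentyThree_W_of_mem_ipwb_twenty_of_visits_eq_three hm hω hv
    exact Finset.mem_image_of_mem _ (Finset.mem_univ i)
  · intro h
    obtain ⟨i, -, rfl⟩ := Finset.mem_image.1 h
    exact ⟨TwentyThree.W_mem_ipwb hm i, by rw [hm]; exact TwentyThree.visits_W i⟩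

open Classical in
/-- ★★★ **`N₁₀,₃ = 7`**: there are exactly seven three-visit irreducible positive wall bridges of length twenty (symbolic length).
[cite: MadrasSlade1993, Section 4.2, Definition 4.2.1, (4.2.2) and Theorem 4.2.2 (pp. 91–92)] [cite: Kesten1963SAW, Section 4] -/
theorem card_threeVisit_ipwb_twenty_eq_seven {m : ℕ} (hm : m = 20) : #((ipwb m).filter fun ω => visits m ω = 3) = 7 := by
  rw [threeVisit_ipwb_twenty_eq_image hm, Finset.card_image_of_injective _ TwentyThree.W_injective]
  simp

/-! ### §5  Laws: `Λ₁₆ = 38y + 11y²`, `f₈` exact, `Λ₁₈ = N₉,₁ y + 34y² + y³`, `Λ₂₀ = N₁₀,₁ y + N₁₀,₂ y² + 7y³` -/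

/-- ★★★ **`Λ₁₆(y) = 38y + 11y²`** (symbolic length). [cite: MadrasSlade1993, Section 4.2, (4.2.2) (p. 91)] [cite: Kesten1963SAW, Section 4] -/
theorem IPWB_sixteen_eq_thirtyEight {m : ℕ} (hm : m = 16) (y : ℝ) : IPWB m y = 38 * y + 11 * y ^ 2 := by
  classical
  rw [IPWB_sixteen_eq hm, card_oneVisit_ipwb_sixteen_eq_thirtyEight hm]
  norm_num

/-- ★★ **`f₈(y) = (38y + 11y²)/β(y)¹⁶`** — the renewal law is explicit through half-length eight. [cite: MadrasSlade1993, Section 4.2, (4.2.2), (4.2.4) (p. 91)] -/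
theorem pwbLaw_eight_eq_exact (y : ℝ) : pwbLaw y 8 = (38 * y + 11 * y ^ 2) / wallRate y ^ 16 := by
  obtain ⟨m, hm⟩ : ∃ m : ℕ, m = 16 := ⟨_, rfl⟩
  have e : pwbLaw y 8 = IPWB m y / wallRate y ^ m := by rw [pwbLaw, hm]
  rw [e, IPWB_sixteen_eq_thirtyEight hm, hm]

open Classical in
/-- The visit monomials of the thirty-four two-visit eighteens sum to `34y²` (symbolic length). [cite: BeatonBousquetMelouDeGierDuminilCopinGuttmann2014, Section 3.1 (arXiv v5 p. 8)] -/
theorem sum_image_eighteenTwo {m : ℕ} (hm : m = 18) (y : ℝ) : ∑ ω ∈ Finset.univ.image EighteenTwo.W, y ^ visits m ω = 34 * y ^ 2 := by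
  rw [Finset.sum_image fun i _ j _ h => EighteenTwo.W_injective h]
  have hv : ∀ i : Fin 34, visits m (EighteenTwo.W i) = 2 := by rw [hm]; exact EighteenTwo.visits_W
  rw [Finset.sum_congr rfl fun i _ => by rw [hv i], Finset.sum_const, Finset.card_univ, Fintype.card_fin, nsmul_eq_mul]
  norm_num

open Classical in
/-- ★ **`Λ₁₈(y) = N₉,₁·y + 34y² + y³`** with `N₉,₁` the number of one-visit irreducible blocks of length eighteen (symbolic; data `98`).
[cite: MadrasSlade1993, Section 4.2, (4.2.2) (p. 91)] [cite: Kesten1963SAW, Section 4] -/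
theorem IPWB_eighteen_eq {m : ℕ} (hm : m = 18) (y : ℝ) :
    IPWB m y = #((ipwb m).filter fun ω => visits m ω = 1) * y + 34 * y ^ 2 + y ^ 3 := by
  rw [IPWB, ← Finset.sum_filter_add_sum_filter_not (ipwb m) (fun ω => visits m ω = 1)]
  have hsplit : ((ipwb m).filter fun ω => ¬ visits m ω = 1) =
      ((ipwb m).filter fun ω => visits m ω = 2) ∪ ((ipwb m).filter fun ω => visits m ω = 3) := by
    ext ω
    simp only [Finset.mem_filter, Finset.mem_union]
    constructor
    · rintro ⟨hω, h1⟩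
      have h0 := one_le_visits_of_mem_ipwb hω
      have h3 := visits_le_three_of_mem_ipwb_eighteen hm hω
      rcases (by omega : visits m ω = 2 ∨ visits m ω = 3) with h | h
      · exact Or.inl ⟨hω, h⟩
      · exact Or.inr ⟨hω, h⟩
    · rintro (⟨hω, h⟩ | ⟨hω, h⟩) <;> exact ⟨hω, by omega⟩
  have hdisj : Disjoint ((ipwb m).filter fun ω => visits m ω = 2) ((ipwb m).filter fun ω => visits m ω = 3) :=
    Finset.disjoint_filter.2 fun ω _ h2 h3 => by omega
  have hv3 : visits m (EighteenThree.W 0) = 3 := by rw [hm]; exact EighteenThree.visits_W 0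
  have hone : ∑ ω ∈ (ipwb m).filter (fun ω => visits m ω = 1), y ^ visits m ω = #((ipwb m).filter fun ω => visits m ω = 1) * y := by
    rw [Finset.sum_congr rfl fun ω hω => by rw [(Finset.mem_filter.1 hω).2, pow_one], Finset.sum_const, nsmul_eq_mul]
  have htwo : ∑ ω ∈ (ipwb m).filter (fun ω => visits m ω = 2), y ^ visits m ω = 34 * y ^ 2 := by
    rw [twoVisit_ipwb_eighteen_eq_image hm, sum_image_eighteenTwo hm]
  have hthree : ∑ ω ∈ (ipwb m).filter (fun ω => visits m ω = 3), y ^ visits m ω = y ^ 3 := by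
    rw [threeVisit_ipwb_eighteen_eq hm, Finset.sum_singleton, hv3]
  rw [hsplit, Finset.sum_union hdisj, hone, htwo, hthree]
  ring

open Classical in
/-- The visit monomials of the seven three-visit twenties sum to `7y³` (symbolic length). [cite: BeatonBousquetMelouDeGierDuminilCopinGuttmann2014, Section 3.1 (arXiv v5 p. 8)] -/
theorem sum_image_twentyThree {m : ℕ} (hm : m = 20) (y : ℝ) : ∑ ω ∈ Finset.univ.image TwentyThree.W, y ^ visits m ω = 7 * y ^ 3 := by
  rw [Finset.sum_image fun i _ j _ h => TwentyThree.W_injective h]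
  have hv : ∀ i : Fin 7, visits m (TwentyThree.W i) = 3 := by rw [hm]; exact TwentyThree.visits_W
  rw [Finset.sum_congr rfl fun i _ => by rw [hv i], Finset.sum_const, Finset.card_univ, Fintype.card_fin, nsmul_eq_mul]
  norm_num

open Classical in
/-- ★ **`Λ₂₀(y) = N₁₀,₁·y + N₁₀,₂·y² + 7y³`** with `N₁₀,₁`, `N₁₀,₂` the one- and two-visit class numbers of length twenty (symbolic; data `267`, `99`).
[cite: MadrasSlade1993, Section 4.2, (4.2.2) (p. 91)] [cite: Kesten1963SAW, Section 4] -/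
theorem IPWB_twenty_eq {m : ℕ} (hm : m = 20) (y : ℝ) :
    IPWB m y = #((ipwb m).filter fun ω => visits m ω = 1) * y + #((ipwb m).filter fun ω => visits m ω = 2) * y ^ 2 + 7 * y ^ 3 := by
  rw [IPWB, ← Finset.sum_filter_add_sum_filter_not (ipwb m) (fun ω => visits m ω = 1)]
  have hsplit : ((ipwb m).filter fun ω => ¬ visits m ω = 1) =
      ((ipwb m).filter fun ω => visits m ω = 2) ∪ ((ipwb m).filter fun ω => visits m ω = 3) := by
    ext ω
    simp only [Finset.mem_filter, Finset.mem_union]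
    constructor
    · rintro ⟨hω, h1⟩
      have h0 := one_le_visits_of_mem_ipwb hω
      have h3 := visits_le_three_of_mem_ipwb_twenty hm hω
      rcases (by omega : visits m ω = 2 ∨ visits m ω = 3) with h | h
      · exact Or.inl ⟨hω, h⟩
      · exact Or.inr ⟨hω, h⟩
    · rintro (⟨hω, h⟩ | ⟨hω, h⟩) <;> exact ⟨hω, by omega⟩
  have hdisj : Disjoint ((ipwb m).filter fun ω => visits m ω = 2) ((ipwb m).filter fun ω => visits m ω = 3) :=
    Finset.disjoint_filter.2 fun ω _ h2 h3 => by omega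
  have hone : ∑ ω ∈ (ipwb m).filter (fun ω => visits m ω = 1), y ^ visits m ω = #((ipwb m).filter fun ω => visits m ω = 1) * y := by
    rw [Finset.sum_congr rfl fun ω hω => by rw [(Finset.mem_filter.1 hω).2, pow_one], Finset.sum_const, nsmul_eq_mul]
  have htwo : ∑ ω ∈ (ipwb m).filter (fun ω => visits m ω = 2), y ^ visits m ω = #((ipwb m).filter fun ω => visits m ω = 2) * y ^ 2 := by
    rw [Finset.sum_congr rfl fun ω hω => by rw [(Finset.mem_filter.1 hω).2], Finset.sum_const, nsmul_eq_mul]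
  have hthree : ∑ ω ∈ (ipwb m).filter (fun ω => visits m ω = 3), y ^ visits m ω = 7 * y ^ 3 := by
    rw [threeVisit_ipwb_twenty_eq_image hm, sum_image_twentyThree hm]
  rw [hsplit, Finset.sum_union hdisj, hone, htwo, hthree]
  ring

end Literature.Probability.RandomPlanarGeometry.SAW.HexBW.Wall
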